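import Summits.FinalStateConjecture.FinalStateConjecture.Theorems.ExactKerrEndsTameEscapeToKerrEndsNonposMass
import Mathlib.Geometry.Manifold.PartitionOfUnity
import Mathlib.Order.PartialSups
import HarnessLib

/-!
# Route `ExactKerrEnds`, crux `TameEscapeToKerrEnds` (stmt-FinalStateConjecture-18522), line
# `matched-kerr-solution-map`: the CURVE-indexed form of the analytic stub S1

The registered stub S1 `MatchedKerrGluingFamily` asks for a RADIUS-indexed family `G R` of glued data,
jointly smooth in `(R, x)`: the selected Kerr parameters must then depend smoothly ON THE GLUING RADIUS
(the first `why_might_fail` of the crux: Corvino–Schoen's degree argument gives no such dependence).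
This file shows the line needs less: a smooth CURVE `s ↦ G s` of admissible Kerr-ended glued data whose
gluing radius `ρ s` merely tends to infinity along the curve (no monotonicity, continuity or smoothness
of `ρ`, no graph over the radius), i.e. exactly what a finite-dimensional continuation / generic
transversality argument on the `10`-dimensional balance map `(R, θ) ↦ Φ(R, θ)` delivers (a proper
smooth branch of the zero set leaving every bounded radius range).

* `exists_contDiff_forall_le` — a locally bounded function on `ℝ` has a `C^∞` majorant (smooth
  partitions of unity, `exists_contMDiffMap_forall_mem_convex_of_local_const`);
* `exists_contDiff_reparam_of_tendsto_atTop` — for `ρ → ∞` along `atTop` there is a `C^∞`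
  reparametrisation `τ` with `τ t > s⋆`, `t < ρ (τ t)` and `t ≤ τ t`;
* `smoothSectionsOn_comp_param` — joint smoothness of `(s, x) ↦ G s x` is stable under a smooth
  reparametrisation of the parameter;
* `tameJunction_of_radius` — the landed tame junction `tameJunction` (stub S3b) for curve-indexed
  families: reparametrise by `τ`, so that `G (τ R)` agrees with `d` off `e.far R` (`AFEnd.far_mono`);
* `tameEscapeToKerrEnds_of_matchedKerrGluingCurve_of_nonposMassKerrEnded` and
  `tameEscapeToKerrEnds_of_matchedKerrGluingCurve_of_pmt_of_rigidity` — the crux from the curve-indexed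
  S1♭ and S2 (resp. the two named positive-mass facts), over the landed S3a/S3b;
* `matchedKerrGluingCurve_of_matchedKerrGluingFamily` — S1 (verbatim) implies S1♭ (`ρ = id`).

References: Christodoulou, CQG 16 (1999) A23, p. A24; Corvino–Schoen, JDG 73 (2006), Thm 4;
Chruściel–Delay, Mém. SMF 94 (2003), Thm 8.1; Mao–Oh–Tao arXiv:2308.13031, Thm 1.3, Lemma 5.5.
-/

set_option linter.dupNamespace false

noncomputable section

namespace Summit.FinalStateConjecture.FinalStateConjecture.Theorems.ExactKerrEnds

open scoped Manifold ContDiff Topology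
open Set Filter Function TopologicalSpace Literature.Geometry.Lorentzian
open Summit.FinalStateConjecture.FinalStateConjecture.Theorems.SwallowTheDatum.ParametricKerrBurial
  (SmoothSectionsOn AgreeAt)

/-! ## §1 Smooth majorants and the reparametrisation of the gluing radius -/

/-- **A locally bounded function on `ℝ` has a smooth majorant.** If every point has a neighbourhood on
which `b` is bounded above, there is a `C^∞` function `τ ≥ b` (glue the local constant bounds by a smooth
partition of unity: `exists_contMDiffMap_forall_mem_convex_of_local_const` with the convex sets
`[b x, ∞)`). [folklore] -/
theorem exists_contDiff_forall_le {b : ℝ → ℝ} (hb : ∀ x : ℝ, ∃ c : ℝ, ∀ᶠ y in 𝓝 x, b y ≤ c) :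
    ∃ τ : ℝ → ℝ, ContDiff ℝ ∞ τ ∧ ∀ x, b x ≤ τ x := by
  obtain ⟨g, hg⟩ := exists_contMDiffMap_forall_mem_convex_of_local_const (n := (⊤ : ℕ∞)) (F := ℝ)
    𝓘(ℝ, ℝ) (t := fun x : ℝ ↦ Ici (b x)) (fun x ↦ convex_Ici (b x))
    (fun x ↦ by
      obtain ⟨c, hc⟩ := hb x
      exact ⟨c, hc.mono fun y hy ↦ mem_Ici.mpr hy⟩)
  exact ⟨g, contMDiff_iff_contDiff.mp g.contMDiff, fun x ↦ mem_Ici.mp (hg x)⟩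

/-- **Smooth reparametrisation of a receding radius.** If `ρ s → ∞` as `s → ∞`, then for every
threshold `s⋆` there is a `C^∞` function `τ : ℝ → ℝ` with `s⋆ < τ t`, `t < ρ (τ t)` and `t ≤ τ t` for
all `t`: choose for each `n : ℕ` a threshold `S n ≥ max(s⋆, n)` beyond which `ρ ≥ n + 1`, make the
thresholds monotone (`partialSups`), and take a smooth majorant of the locally bounded step function
`t ↦ S ⌈t⌉₊`. [folklore] -/
theorem exists_contDiff_reparam_of_tendsto_atTop {ρ : ℝ → ℝ} (hρ : Tendsto ρ atTop atTop)
    (sstar : ℝ) :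
    ∃ τ : ℝ → ℝ, ContDiff ℝ ∞ τ ∧ (∀ t, sstar < τ t) ∧ (∀ t, t < ρ (τ t)) ∧ ∀ t, t ≤ τ t := by
  have hS : ∀ n : ℕ, ∃ a : ℝ, sstar < a ∧ (n : ℝ) ≤ a ∧ ∀ s, a ≤ s → (n : ℝ) + 1 ≤ ρ s := by
    intro n
    obtain ⟨a₀, ha₀⟩ := eventually_atTop.mp (hρ.eventually (eventually_ge_atTop ((n : ℝ) + 1)))
    refine ⟨max a₀ (max (sstar + 1) n), ?_, ?_, fun s hs ↦ ha₀ s ?_⟩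
    · exact lt_of_lt_of_le (lt_add_one sstar) ((le_max_left _ _).trans (le_max_right _ _))
    · exact (le_max_right _ _).trans (le_max_right _ _)
    · exact (le_max_left _ _).trans hs
  choose S hS₁ hS₂ hS₃ using hS
  have hSA : ∀ n, S n ≤ partialSups S n := fun n ↦ le_partialSups S n
  have hAmono : Monotone (partialSups S) := (partialSups S).monotone
  obtain ⟨τ, hτ, hbτ⟩ :=
    exists_contDiff_forall_le (b := fun t : ℝ ↦ partialSups S ⌈t⌉₊) (fun x ↦ by
      refine ⟨partialSups S (⌈x⌉₊ + 1), ?_⟩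
      filter_upwards [Iic_mem_nhds (lt_add_one x)] with y hy
      refine hAmono (Nat.ceil_le.mpr ?_)
      have hy' : y ≤ x + 1 := mem_Iic.mp hy
      push_cast
      linarith [Nat.le_ceil x])
  refine ⟨τ, hτ, fun t ↦ ?_, fun t ↦ ?_, fun t ↦ ?_⟩
  · exact (hS₁ _).trans_le ((hSA _).trans (hbτ t))
  · have h1 : (⌈t⌉₊ : ℝ) + 1 ≤ ρ (τ t) := hS₃ _ _ ((hSA _).trans (hbτ t))
    linarith [Nat.le_ceil t]
  · exact (Nat.le_ceil t).trans ((hS₂ _).trans ((hSA _).trans (hbτ t)))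

/-! ## §2 Reparametrising jointly smooth families -/

variable {X : Type} [TopologicalSpace X] [ChartedSpace E3 X] [IsManifold (𝓡 3) ∞ X]

/-- **Joint smoothness is stable under a smooth reparametrisation.** If `(s, x) ↦ G s x` is a jointly
smooth family of sections on `{s⋆ < s} × X` and `τ` is a `C^∞` function mapping `(R⋆, ∞)` into
`(s⋆, ∞)`, then `(R, x) ↦ G (τ R) x` is jointly smooth on `{R⋆ < R} × X`. [folklore] -/
theorem smoothSectionsOn_comp_param {G : ℝ → InitialDataSet (𝓡 3) X} {sstar Rstar : ℝ} {τ : ℝ → ℝ}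
    (hG : SmoothSectionsOn 𝓘(ℝ, ℝ) G {p : ℝ × X | sstar < p.1}) (hτ : ContDiff ℝ ∞ τ)
    (hτs : ∀ t, Rstar < t → sstar < τ t) :
    SmoothSectionsOn 𝓘(ℝ, ℝ) (G ∘ τ) {p : ℝ × X | Rstar < p.1} := by
  have hΦ : ContMDiff (𝓘(ℝ, ℝ).prod (𝓡 3)) (𝓘(ℝ, ℝ).prod (𝓡 3)) ∞
      (fun p : ℝ × X ↦ (τ p.1, p.2)) :=
    ((contMDiff_iff_contDiff.mpr hτ).comp contMDiff_fst).prodMk contMDiff_snd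
  have hmaps : {p : ℝ × X | Rstar < p.1} ⊆ (fun p : ℝ × X ↦ (τ p.1, p.2)) ⁻¹' {p | sstar < p.1} :=
    fun p hp ↦ hτs _ hp
  exact ⟨hG.1.comp hΦ.contMDiffOn hmaps, hG.2.comp hΦ.contMDiffOn hmaps⟩

/-! ## §3 The tame junction for curve-indexed families -/

/-- **The tame junction along a curve of glued data (curve-indexed form of stub S3b `TameJunction`).**
Let `d` be admissible with sole DR end `e` of mass parameter `M`, and let `s ↦ G s` (`s > s⋆`) be a
curve of admissible Kerr-ended data, jointly smooth in `(s, x)`, with `G s = d` off `e.far (ρ s)` for a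
gluing radius `ρ s → ∞` (no monotonicity or continuity of `ρ` is assumed), DR-flat on `e` with masses
`m s → M` (`m` continuous), and `e.wDist (G s) d → 0`.  Then through `d` passes a tame, injective,
immersed curve of admissible data whose members off `0` are Kerr-ended.  Proof: reparametrise by a
smooth `τ` with `R < ρ (τ R)` and `τ R → ∞` (`exists_contDiff_reparam_of_tendsto_atTop`); the family
`R ↦ G (τ R)` agrees with `d` off `e.far R ⊇ e.far (ρ (τ R))` and satisfies every hypothesis of the
landed radius-indexed `tameJunction`. [cite: Christodoulou1999, p. A24] -/
theorem tameJunction_of_radius :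
    ∀ (X : Type) [TopologicalSpace X] [ChartedSpace E3 X] [IsManifold (𝓡 3) ∞ X] [T2Space X]
      [SecondCountableTopology X] [ConnectedSpace X],
      ∀ (d : InitialDataSet (𝓡 3) X) (e : AFEnd X) (M sstar : ℝ) (ρ m : ℝ → ℝ)
        (G : ℝ → InitialDataSet (𝓡 3) X),
        d ∈ admissibleVacuumData X → e.IsSoleEnd → e.IsStronglyAsymptoticallyFlatDR d M →
        Tendsto ρ atTop atTop → ContinuousOn m (Ioi sstar) → Tendsto m atTop (𝓝 M) →
        SmoothSectionsOn 𝓘(ℝ, ℝ) G {p : ℝ × X | sstar < p.1} →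
        (∀ s : ℝ, sstar < s →
          G s ∈ admissibleVacuumData X ∧ (∀ x ∉ e.far (ρ s), AgreeAt (G s) d x) ∧
            e.IsStronglyAsymptoticallyFlatDR (G s) (m s) ∧ (G s).HasExactKerrEnd) →
        Tendsto (fun s ↦ e.wDist (G s) d) atTop (𝓝 0) →
        ∃ (e' : AFEnd X) (F : EuclideanSpace ℝ (Fin 1) → InitialDataSet (𝓡 3) X),
          InitialDataSet.IsTameDataFamily e' 1 F ∧ InitialDataSet.IsImmersedAtZero 1 F ∧ F 0 = d ∧
            Injective F ∧ (∀ c, F c ∈ admissibleVacuumData X) ∧ ∀ c ≠ 0, (F c).HasExactKerrEnd := by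
  intro X _ _ _ _ _ _ d e M sstar ρ m G hd hsole hDR hρ hm hmM hG hGs hw
  obtain ⟨τ, hτ, hτs, hτρ, hτt⟩ := exists_contDiff_reparam_of_tendsto_atTop hρ sstar
  have hτtop : Tendsto τ atTop atTop := tendsto_atTop_mono hτt tendsto_id
  refine tameJunction X d e M (e.R + 1) (m ∘ τ) (G ∘ τ) hd hsole hDR (lt_add_one _) ?_ ?_ ?_ ?_ ?_
  · exact hm.comp hτ.continuous.continuousOn fun t _ ↦ hτs t
  · exact hmM.comp hτtop
  · exact smoothSectionsOn_comp_param hG hτ fun t _ ↦ hτs t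
  · intro R _
    obtain ⟨hadm, hagree, hdecay, hkerr⟩ := hGs (τ R) (hτs R)
    exact ⟨hadm, fun x hx ↦ hagree x fun hx' ↦ hx (e.far_mono (hτρ R).le hx'), hdecay, hkerr⟩
  · exact hw.comp hτtop

/-! ## §4 The crux from the curve-indexed S1♭ -/

omit [IsManifold (𝓡 3) ∞ X] in
/-- **`TameEscapeToKerrEnds` from the CURVE-indexed matched Kerr gluing S1♭ and S2.**  S1♭: for an
admissible `d` with sole DR end `e` of mass parameter `M > 0` there is a curve `s ↦ G s` (`s > s⋆`) of
admissible Kerr-ended data, jointly smooth in `(s, x)`, equal to `d` off `e.far (ρ s)` with `ρ s → ∞`,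
DR-flat on `e` with continuous masses `m s → M`, and `e.wDist (G s) d → 0`.  With S2 (non-positive mass
parameter forces an exact Kerr end) this gives the crux: for an exceptional `d`, `M ≤ 0` is excluded by
S2 and for `M > 0` the curve-indexed tame junction `tameJunction_of_radius` produces the witness curve.
[folklore] -/
theorem tameEscapeToKerrEnds_of_matchedKerrGluingCurve_of_nonposMassKerrEnded :
    (∀ (X : Type) [TopologicalSpace X] [ChartedSpace E3 X] [IsManifold (𝓡 3) ∞ X] [T2Space X]
      [SecondCountableTopology X] [ConnectedSpace X], ∀ [Kerr.Facts],
      ∀ d ∈ admissibleVacuumData X, ∀ (e : AFEnd X) (M : ℝ), e.IsSoleEnd → 0 < M →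
        e.IsStronglyAsymptoticallyFlatDR d M →
        ∃ (sstar : ℝ) (ρ m : ℝ → ℝ) (G : ℝ → InitialDataSet (𝓡 3) X),
          Tendsto ρ atTop atTop ∧ ContinuousOn m (Ioi sstar) ∧ Tendsto m atTop (𝓝 M) ∧
          SmoothSectionsOn 𝓘(ℝ, ℝ) G {p : ℝ × X | sstar < p.1} ∧
          (∀ s : ℝ, sstar < s →
            G s ∈ admissibleVacuumData X ∧ (∀ x ∉ e.far (ρ s), AgreeAt (G s) d x) ∧
              e.IsStronglyAsymptoticallyFlatDR (G s) (m s) ∧ (G s).HasExactKerrEnd) ∧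
          Tendsto (fun s ↦ e.wDist (G s) d) atTop (𝓝 0)) →
    (∀ (X : Type) [TopologicalSpace X] [ChartedSpace E3 X] [IsManifold (𝓡 3) ∞ X] [T2Space X]
      [SecondCountableTopology X] [ConnectedSpace X],
      ∀ d ∈ admissibleVacuumData X, ∀ (e : AFEnd X) (M : ℝ), e.IsSoleEnd → M ≤ 0 →
        e.IsStronglyAsymptoticallyFlatDR d M → d.HasExactKerrEnd) →
    Summit.FinalStateConjecture.FinalStateConjecture.Theses.ExactKerrEnds.TameEscapeToKerrEnds := by
  intro h1 h2 X _ _ _ _ _ _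
  -- the crux, with its let-bound legend `KerrEnded` zeta-reduced, is tame genericity of `HasExactKerrEnd`
  show InitialDataSet.IsTameChristodoulouGeneric (admissibleVacuumData X)
    (fun D : InitialDataSet (𝓡 3) X ↦ D.HasExactKerrEnd) 1
  intro d hd
  obtain ⟨hd𝓓, hdexc⟩ := hd
  by_cases hKF : Kerr.Facts
  · obtain ⟨-, e, M, hsole, hDR⟩ := id hd𝓓
    by_cases hM : 0 < M
    · obtain ⟨sstar, ρ, m, G, hρ, hm, hmM, hG, hmem, hw⟩ := h1 X d hd𝓓 e M hsole hM hDR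
      obtain ⟨e', F, htame, himm, hF0, hinj, hadm, hK⟩ :=
        tameJunction_of_radius X d e M sstar ρ m G hd𝓓 hsole hDR hρ hm hmM hG hmem hw
      exact ⟨e', F, htame, himm, hF0, hinj, hadm, fun c hc hmem_exc ↦ hmem_exc.2 (hK c hc)⟩
    · exact (hdexc (h2 X d hd𝓓 e M hsole (not_lt.mp hM) hDR)).elim
  · exact absurd (fun hinst ↦ absurd hinst hKF) hdexc

omit [IsManifold (𝓡 3) ∞ X] in
/-- **The crux modulo the curve-indexed S1♭ and the two named positive-mass facts.**  With S2 discharged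
conditionally (`nonposMassKerrEnded_of_pmt_of_rigidity`: Eichmair–Huang–Lee–Schoen 2016 Thm 1 and
Beig–Chruściel 1996 Thm 4.1), the crux `TameEscapeToKerrEnds` follows from the curve-indexed matched
Kerr gluing S1♭ alone over `positive_mass_theorem_spacetime` and `positive_mass_rigidity_spacetime`.
[cite: BeigChrusciel1996, Thm. 4.1] -/
theorem tameEscapeToKerrEnds_of_matchedKerrGluingCurve_of_pmt_of_rigidity :
    (∀ (X : Type) [TopologicalSpace X] [ChartedSpace E3 X] [IsManifold (𝓡 3) ∞ X] [T2Space X]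
      [SecondCountableTopology X] [ConnectedSpace X], ∀ [Kerr.Facts],
      ∀ d ∈ admissibleVacuumData X, ∀ (e : AFEnd X) (M : ℝ), e.IsSoleEnd → 0 < M →
        e.IsStronglyAsymptoticallyFlatDR d M →
        ∃ (sstar : ℝ) (ρ m : ℝ → ℝ) (G : ℝ → InitialDataSet (𝓡 3) X),
          Tendsto ρ atTop atTop ∧ ContinuousOn m (Ioi sstar) ∧ Tendsto m atTop (𝓝 M) ∧
          SmoothSectionsOn 𝓘(ℝ, ℝ) G {p : ℝ × X | sstar < p.1} ∧
          (∀ s : ℝ, sstar < s →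
            G s ∈ admissibleVacuumData X ∧ (∀ x ∉ e.far (ρ s), AgreeAt (G s) d x) ∧
              e.IsStronglyAsymptoticallyFlatDR (G s) (m s) ∧ (G s).HasExactKerrEnd) ∧
          Tendsto (fun s ↦ e.wDist (G s) d) atTop (𝓝 0)) →
    positive_mass_theorem_spacetime → positive_mass_rigidity_spacetime →
    Summit.FinalStateConjecture.FinalStateConjecture.Theses.ExactKerrEnds.TameEscapeToKerrEnds :=
  fun h1 hpmt hrig ↦ tameEscapeToKerrEnds_of_matchedKerrGluingCurve_of_nonposMassKerrEnded h1
    (nonposMassKerrEnded_of_pmt_of_rigidity hpmt hrig)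

/-! ## §5 The registered radius-indexed S1 implies the curve-indexed S1♭ -/

omit [IsManifold (𝓡 3) ∞ X] in
/-- **S1 ⇒ S1♭.**  The registered radius-indexed stub `MatchedKerrGluingFamily` (chart-exact Kerr beyond
`4R`, stated verbatim) implies the curve-indexed form with `ρ = id`: chart-level exact Kerr beyond
`4R ≥ e.R` on a sole end is an exact Kerr end (`chartKerrEnd`, stub S3a). [folklore] -/
theorem matchedKerrGluingCurve_of_matchedKerrGluingFamily
    (h1 : ∀ (X : Type) [TopologicalSpace X] [ChartedSpace E3 X] [IsManifold (𝓡 3) ∞ X] [T2Space X]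
      [SecondCountableTopology X] [ConnectedSpace X], ∀ [Kerr.Facts],
      ∀ d ∈ admissibleVacuumData X, ∀ (e : AFEnd X) (M : ℝ), e.IsSoleEnd → 0 < M →
        e.IsStronglyAsymptoticallyFlatDR d M →
        ∃ (Rstar : ℝ) (m : ℝ → ℝ) (G : ℝ → InitialDataSet (𝓡 3) X),
          e.R < Rstar ∧ ContinuousOn m (Ioi Rstar) ∧ Tendsto m atTop (𝓝 M) ∧
          SmoothSectionsOn 𝓘(ℝ, ℝ) G {p : ℝ × X | Rstar < p.1} ∧
          (∀ R : ℝ, Rstar < R →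
            G R ∈ admissibleVacuumData X ∧ (∀ x ∉ e.far R, AgreeAt (G R) d x) ∧
              e.IsStronglyAsymptoticallyFlatDR (G R) (m R) ∧
              ∃ (M' a r₀ : ℝ) (hM' : 0 ≤ M') (ψ : exteriorRegion (4 * R) → Kerr.region a r₀)
                (ν : NormalField 𝓘(ℝ, E4) ψ),
                Injective ψ ∧
                (Kerr.smoothMetric M' a r₀).IsSpacelikeImmersion 𝓘(ℝ, E3) ψ ∧
                (Kerr.smoothMetric M' a r₀).IsFutureUnitNormal 𝓘(ℝ, E3)
                  ((Kerr.timeOrientation M' a r₀ hM').ofLE le_top) ψ ν ∧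
                (∀ (y : exteriorRegion (4 * R)) (v w : E3),
                  AFEnd.hCoeff e (G R) (y : E3) v w =
                    Kerr.bilin M' a (ψ y : E4) (mfderiv 𝓘(ℝ, E3) 𝓘(ℝ, E4) ψ y v)
                      (mfderiv 𝓘(ℝ, E3) 𝓘(ℝ, E4) ψ y w)) ∧
                (∀ [(Kerr.smoothMetric M' a r₀).HasLeviCivita] (y : exteriorRegion (4 * R)) (v w : E3),
                  AFEnd.kCoeff e (G R) (y : E3) v w =
                    (Kerr.smoothMetric M' a r₀).secondFundamentalForm 𝓘(ℝ, E3) ψ ν y v w)) ∧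
          Tendsto (fun R ↦ e.wDist (G R) d) atTop (𝓝 0)) :
    ∀ (X : Type) [TopologicalSpace X] [ChartedSpace E3 X] [IsManifold (𝓡 3) ∞ X] [T2Space X]
      [SecondCountableTopology X] [ConnectedSpace X], ∀ [Kerr.Facts],
      ∀ d ∈ admissibleVacuumData X, ∀ (e : AFEnd X) (M : ℝ), e.IsSoleEnd → 0 < M →
        e.IsStronglyAsymptoticallyFlatDR d M →
        ∃ (sstar : ℝ) (ρ m : ℝ → ℝ) (G : ℝ → InitialDataSet (𝓡 3) X),
          Tendsto ρ atTop atTop ∧ ContinuousOn m (Ioi sstar) ∧ Tendsto m atTop (𝓝 M) ∧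
          SmoothSectionsOn 𝓘(ℝ, ℝ) G {p : ℝ × X | sstar < p.1} ∧
          (∀ s : ℝ, sstar < s →
            G s ∈ admissibleVacuumData X ∧ (∀ x ∉ e.far (ρ s), AgreeAt (G s) d x) ∧
              e.IsStronglyAsymptoticallyFlatDR (G s) (m s) ∧ (G s).HasExactKerrEnd) ∧
          Tendsto (fun s ↦ e.wDist (G s) d) atTop (𝓝 0) := by
  intro X _ _ _ _ _ _ _ d hd e M hsole hM hDR
  obtain ⟨Rstar, m, G, hRstar, hm, hmM, hG, hmem, hw⟩ := h1 X d hd e M hsole hM hDR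
  refine ⟨Rstar, id, m, G, tendsto_id, hm, hmM, hG, fun R hR ↦ ?_, hw⟩
  obtain ⟨hadm, hagree, hdecay, hkerr⟩ := hmem R hR
  refine ⟨hadm, hagree, hdecay, chartKerrEnd X e (G R) (4 * R) hsole ?_ hkerr⟩
  have hRpos : 0 < R := lt_trans e.R_pos (lt_trans hRstar hR)
  show e.R ≤ 4 * R
  linarith

end Summit.FinalStateConjecture.FinalStateConjecture.Theorems.ExactKerrEnds

end
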